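import Summits.NavierStokesRegularity.NavierStokesRegularity.Theses.AxisymmetricExtremality
import Summits.NavierStokesRegularity.NavierStokesRegularity.Theorems.AxisymmetricExtremalityAxisymmetricKatoGlobalStubSereginLogSwirlOriginStep3LocalEquationsPhi
import Literature.Analysis.FluidPDE.NSVorticityOfSmoothRepresentative
import Literature.Analysis.FluidPDE.SereginZajaczkowski2007
import HarnessLib

/-!
# Seregin 2022, §2 Step 3 for the LOCAL smooth class (III): the `Γ`- and `Φ`-equations for
# the Seregin–Zajaczkowski class on an open product region — crux stmt-NavierStokesRegularity-15453
# (`AxisymmetricExtremality.AxisymmetricKatoGlobal`), line registered, support for stub `stub_sereginLogSwirlOrigin`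

Support file (`--supports stmt-NavierStokesRegularity-15453`; theorems only, everything proved)
toward the registered stub `stub_sereginLogSwirlOrigin` = the named fact
`Literature.Analysis.FluidPDE.seregin2022_logSwirl_regularAtOrigin` (G. Seregin, J. Math. Fluid
Mech. 24 (2022), Paper 27 = arXiv:2201.00153, §2), sequel of `…Step3LocalEquations(Phi)`.
The final reduction of the fact (`seregin2022_logSwirl_regularAtOrigin_of_cleanRepr`) leaves a
core about a representative `V` with `IsSmoothAxisymmetricSolutionOn (parCylOpens ẑ R) V q`
(suitable weak solution on the open cylinder, `C^∞` slices, jointly continuous spatial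
derivatives; no `∂ₜV`, no regular pressure), whereas the landed Step-3 energy scheme is written
for whole-space classical solutions. This file supplies the two PDE inputs of Step 3 for that
class:

* `hasDerivAt_curl_of_isSmoothAxisymmetricSolutionOn` — on an open product `I × U ⊆ S`, for any
  family `u` agreeing with `V` near each point of `U` (`u t =ᶠ[𝓝 x] V t`), the time line
  `s ↦ curl (u s) x` has derivative `Δω − Dω[u t] + D(u t)[ω]` at `t` (`ω = curl (u t)`): the
  tree's `vorticity_classical_of_isDistributionalNSSolutionOn` (the class supplies `C³` slices
  and jointly continuous `D_xⁿV`, `n ≤ 3`; the pressure is killed by testing with curls) and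
  locality of `curl`, `Δ`, `D`;
* `hasDerivAt_quotients_of_isSmoothAxisymmetricSolutionOn` — for `u` moreover globally `C^∞`
  and axisymmetric at the times of `I` (a cut-off globalisation `χV`), at every `(t, x) ∈ I × U`
  off the axis: `d/ds angVortQuot (u s) x = angVelQuot W x`, `d/ds radVelQuot (curl (u s)) x =
  radVelQuot W x` (`W = Δω − Dω[u t] + D(u t)[ω]`; `hasDerivAt_angVortQuot_of_ne`,
  `hasDerivAt_radVelQuot_curl_of_ne`);
* `seregin_quotientEquations_of_isSmoothAxisymmetricSolutionOn` (registered sub-goal) —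
  **Seregin's equations for the local class in closed form**: off the axis on `I × U`,
  `∂ₜΓ = ΔΓ + 2q_Γ − DΓ[u] − 2(u_θ/r)Φ`, `∂ₜΦ = ΔΦ + 2q_Φ − DΦ[u] + D(u_r/r)[ω]`
  (`angVelQuot_vorticityRHS_eq`, `radVelQuot_vorticityRHS_eq` with `ν = 1`), i.e.
  "`∂ₜΓ + (u − 2x'/|x'|²)·∇Γ − ΔΓ + 2(u_θ/r)Φ = 0`, `∂ₜΦ + (u − 2x'/|x'|²)·∇Φ − ΔΦ −
  ω·∇(u_r/r) = 0`" (arXiv p. 6; `2q_G = (2x'/|x'|²)·∇G`). The axis is Lebesgue-null: this is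
  the input of the localised energy method (differentiation of `∫(ζΓ)²` under the integral
  sign is a.e. in `x`).

## Mathlib / tree search

Tree: `vorticity_classical_of_isDistributionalNSSolutionOn` (`NSVorticityOfSmoothRepresentative`),
`IsSmoothAxisymmetricSolutionOn`, `.continuousOn_iteratedFDeriv`, `.contDiffAt`, `.suitable`
(`SereginZajaczkowski2007`), `IsSuitableWeakSolutionOn.distributional`,
`IsDistributionalNSSolutionOn.of_le`; the same extraction for the 2020 no-swirl core is
`vorticity_hasDerivAt_of_isSmoothAxisymmetricSolutionOn` (`…Seregin2020TypeIINoSwirlCoreScalarEq`,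
not imported). Mathlib: `Filter.EventuallyEq.fderiv_eq`, `Filter.EventuallyEq.eventuallyEq_nhds`,
`InnerProductSpace.laplacian_congr_nhds`. `lean search 'quotientEquations|hasDerivAt_quotients' --decl`:
no matches (2026-08-17).

## References

* G. Seregin, J. Math. Fluid Mech. 24 (2022), Paper No. 27 = arXiv:2201.00153, §2 Step 3
  (arXiv p. 6, the equations of `Φ` and `Γ`). [`Seregin2022LocalAxisym`]
* P. G. Lemarié-Rieusset, *The Navier–Stokes Problem in the 21st Century* (2016),
  doi:10.1201/b19556, Thm. 13.1 proof Step 1 (p. 436), proof of Thm. 15.4 Step 3 ¶1 (p. 569)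
  (the vorticity equation without pressure or time regularity). [`LemarieRieusset2016`]
* G. Seregin, W. Zajaczkowski, SIAM J. Math. Anal. 39 (2007) 669–685, Prop. 4.1 (the class).
  [`SereginZajaczkowski2007`]
-/

noncomputable section

open MeasureTheory Set Function Filter Topology InnerProductSpace WithLp
open scoped RealInnerProductSpace Laplacian ContDiff
open Literature.Analysis.FluidPDE

-- `<Problem> = <Summit>` duplicates a namespace component by design (lakefile sets the same option).
set_option linter.dupNamespace false

namespace Summit.NavierStokesRegularity.NavierStokesRegularity.Theorems.AxisymmetricKatoGlobal.EulerScaling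

/-! ### The equations for the Seregin–Zajaczkowski class on an open product region -/

section LocalClass

open TopologicalSpace Literature.Analysis.FluidPDE.SereginZajaczkowski2007

variable {Scl : Opens (ℝ × EuclideanSpace ℝ (Fin 3))}
  {V u : ℝ → EuclideanSpace ℝ (Fin 3) → EuclideanSpace ℝ (Fin 3)}
  {p : ℝ → EuclideanSpace ℝ (Fin 3) → ℝ} {I : Set ℝ} {U : Set (EuclideanSpace ℝ (Fin 3))}

/-- **The pointwise vorticity equation of the Seregin–Zajaczkowski class, transported to a
globalisation.** Let `(V, p)` be a "sufficiently smooth axially symmetric solution" on an open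
`S ⊇ I × U` (`I`, `U` open) — the class of the smooth representative near regular points: a
suitable weak solution with `C^∞` slices and jointly continuous spatial derivatives, NO time
derivative, NO regular pressure — and let `u` agree with `V` near every point of `U` at the
times of `I` (`u t =ᶠ[𝓝 x] V t`). Then for `(t, x) ∈ I × U` the time line `s ↦ curl (u s) x`
is differentiable at `t` with derivative `Δω − Dω[u] + Du[ω]` at `(t, x)` (`ω = curl (u t)`):
the tree's `vorticity_classical_of_isDistributionalNSSolutionOn` (testing the momentum equation
with curls kills the pressure; du Bois-Reymond in time), and locality of `curl`, `Δ`, `D`.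
[cite: LemarieRieusset2016, Thm. 13.1 proof Step 1 (p. 436) and proof of Thm. 15.4, Step 3 ¶1 (PDF p. 569)] -/
theorem hasDerivAt_curl_of_isSmoothAxisymmetricSolutionOn (hV : IsSmoothAxisymmetricSolutionOn Scl V p)
    (hI : IsOpen I) (hU : IsOpen U) (hsub : I ×ˢ U ⊆ (Scl : Set (ℝ × EuclideanSpace ℝ (Fin 3))))
    (hloc : ∀ t ∈ I, ∀ x ∈ U, u t =ᶠ[𝓝 x] V t) {t : ℝ} (ht : t ∈ I)
    {x : EuclideanSpace ℝ (Fin 3)} (hx : x ∈ U) :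
    HasDerivAt (fun s => curl (u s) x) ((Δ (curl (u t))) x - fderiv ℝ (curl (u t)) x (u t x) +
      fderiv ℝ (u t) x (curl (u t) x)) t := by
  have hO : IsOpen (I ×ˢ U) := hI.prod hU
  have hle : (⟨I ×ˢ U, hO⟩ : Opens (ℝ × EuclideanSpace ℝ (Fin 3))) ≤ Scl := hsub
  have hsol : IsDistributionalNSSolutionOn ⟨I ×ˢ U, hO⟩ 1 0 V p :=
    hV.suitable.distributional.of_le hle
  have hU3 : ∀ t ∈ I, ContDiffOn ℝ 3 (V t) U := fun t ht x hx =>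
    ((hV.contDiffAt (t, x) (hsub ⟨ht, hx⟩)).of_le (by norm_cast)).contDiffWithinAt
  have hΦ : ∀ n ≤ 3, ContinuousOn
      (fun w : ℝ × EuclideanSpace ℝ (Fin 3) => iteratedFDeriv ℝ n (V w.1) w.2) (I ×ˢ U) :=
    fun n _ => (hV.continuousOn_iteratedFDeriv n).mono hsub
  obtain ⟨-, -, hder, -, -⟩ :=
    vorticity_classical_of_isDistributionalNSSolutionOn hI hU hsol hU3 hΦ
  have hderV : HasDerivAt (fun s => curl (V s) x)
      ((Δ (curl (V t))) x - fderiv ℝ (curl (V t)) x (V t x) + fderiv ℝ (V t) x (curl (V t) x)) t := by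
    simpa only [vorticity_apply, convect_apply, one_smul] using hder t ht x hx
  -- locality: `curl (u s) x = curl (V s) x` for `s ∈ I`, and the right-hand sides agree at `x`
  have hcurl_pt : ∀ s ∈ I, curl (u s) x = curl (V s) x := fun s hs => by
    show curlCLM (fderiv ℝ (u s) x) = curlCLM (fderiv ℝ (V s) x)
    rw [(hloc s hs x hx).fderiv_eq]
  have hcurl : curl (u t) =ᶠ[𝓝 x] curl (V t) := by
    filter_upwards [(hloc t ht x hx).eventuallyEq_nhds] with y hy
    show curlCLM (fderiv ℝ (u t) y) = curlCLM (fderiv ℝ (V t) y)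
    rw [hy.fderiv_eq]
  have hev : (fun s => curl (V s) x) =ᶠ[𝓝 t] fun s => curl (u s) x := by
    filter_upwards [hI.mem_nhds ht] with s hs
    exact (hcurl_pt s hs).symm
  refine (hderV.congr_of_eventuallyEq hev.symm).congr_deriv ?_
  rw [(InnerProductSpace.laplacian_congr_nhds hcurl).self_of_nhds, hcurl.fderiv_eq,
    (hloc t ht x hx).self_of_nhds, hcurl.self_of_nhds, (hloc t ht x hx).fderiv_eq]

/-- **The `Γ`- and `Φ`-equations for the Seregin–Zajaczkowski class, time-derivative form
(Seregin 2022, §2 Step 3, for the LOCAL smooth class).** Let `(V, p)` be in the class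
`IsSmoothAxisymmetricSolutionOn S V p` with `S ⊇ I × U` (`I`, `U` open), and let `u` be a
family of globally `C^∞` axisymmetric fields with `u t =ᶠ[𝓝 x] V t` for `t ∈ I`, `x ∈ U` (a
cut-off globalisation of `V`; the quotients below are those of `u`, which near `I × U` are those
of the solution). Then at every `t ∈ I` and every `x ∈ U` OFF the axis, with `ω = curl (u t)` and
the vorticity right-hand side `W = Δω − Dω[u t] + D(u t)[ω]`:
`d/ds angVortQuot (u s) x |ₜ = angVelQuot W x` and `d/ds radVelQuot (curl (u s)) x |ₜ = radVelQuot W x`,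
where by `angVelQuot_vorticityRHS_eq` / `radVelQuot_vorticityRHS_eq` (with `ν = 1`)
`angVelQuot W = ΔΓ + 2q_Γ − DΓ[u] − 2(u_θ/r)Φ` and `radVelQuot W = ΔΦ + 2q_Φ − DΦ[u] + D(u_r/r)[ω]`
on all of `ℝ³` — Seregin's equations `∂ₜΓ + (u − 2x'/|x'|²)·∇Γ − ΔΓ + 2(u_θ/r)Φ = 0`,
`∂ₜΦ + (u − 2x'/|x'|²)·∇Φ − ΔΦ − ω·∇(u_r/r) = 0` (`2q_G = (2x'/|x'|²)·∇G`). The axis is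
Lebesgue-null, so this is what the localised energy method of Step 3 uses.
[cite: Seregin2022LocalAxisym, §2 Step 3 (arXiv:2201.00153 p. 6, the equations of Φ and Γ)] -/
theorem hasDerivAt_quotients_of_isSmoothAxisymmetricSolutionOn
    (hV : IsSmoothAxisymmetricSolutionOn Scl V p) (hI : IsOpen I) (hU : IsOpen U)
    (hsub : I ×ˢ U ⊆ (Scl : Set (ℝ × EuclideanSpace ℝ (Fin 3))))
    (hu : ∀ t ∈ I, ContDiff ℝ ∞ (u t)) (hax : ∀ t ∈ I, IsAxisymmetric (u t))
    (hloc : ∀ t ∈ I, ∀ x ∈ U, u t =ᶠ[𝓝 x] V t) {t : ℝ} (ht : t ∈ I)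
    {x : EuclideanSpace ℝ (Fin 3)} (hx : x ∈ U) (hxr : cylRadius x ≠ 0) :
    HasDerivAt (fun s => angVortQuot (u s) x) (angVelQuot (fun y => (1 : ℝ) • (Δ (curl (u t))) y -
      fderiv ℝ (curl (u t)) y (u t y) + fderiv ℝ (u t) y (curl (u t) y)) x) t ∧
    HasDerivAt (fun s => radVelQuot (curl (u s)) x) (radVelQuot (fun y => (1 : ℝ) • (Δ (curl (u t))) y -
      fderiv ℝ (curl (u t)) y (u t y) + fderiv ℝ (u t) y (curl (u t) y)) x) t := by
  have hder := hasDerivAt_curl_of_isSmoothAxisymmetricSolutionOn hV hI hU hsub hloc ht hx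
  have hder' : HasDerivAt (fun s => curl (u s) x) ((fun y => (1 : ℝ) • (Δ (curl (u t))) y -
      fderiv ℝ (curl (u t)) y (u t y) + fderiv ℝ (u t) y (curl (u t) y)) x) t := by
    simpa only [one_smul] using hder
  have hW : ContDiff ℝ 2 fun y => (1 : ℝ) • (Δ (curl (u t))) y - fderiv ℝ (curl (u t)) y (u t y) +
      fderiv ℝ (u t) y (curl (u t) y) := (contDiff_vorticityRHS (hu t ht) 1).of_le (by norm_cast)
  have hWax : IsAxisymmetric fun y => (1 : ℝ) • (Δ (curl (u t))) y - fderiv ℝ (curl (u t)) y (u t y) +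
      fderiv ℝ (u t) y (curl (u t) y) :=
    isAxisymmetric_vorticityRHS (hax t ht) ((hu t ht).of_le (by norm_cast)) 1
  have hv3 : ∀ s ∈ I, ContDiff ℝ 3 (u s) := fun s hs => (hu s hs).of_le (by norm_cast)
  exact ⟨hasDerivAt_angVortQuot_of_ne hI hv3 hax ht hxr hW hWax hder',
    hasDerivAt_radVelQuot_curl_of_ne hI hv3 hax ht hxr hW hWax hder'⟩

/-- **Seregin's `Γ`- and `Φ`-equations for the Seregin–Zajaczkowski class, in closed form**
(the derivative values of `hasDerivAt_quotients_of_isSmoothAxisymmetricSolutionOn` rewritten by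
the slice identities `angVelQuot_vorticityRHS_eq`, `radVelQuot_vorticityRHS_eq`): off the axis on
`I × U`, `∂ₜΓ = ΔΓ + 2q_Γ − DΓ[u] − 2(u_θ/r)Φ` and `∂ₜΦ = ΔΦ + 2q_Φ − DΦ[u] + D(u_r/r)[ω]`
(`Γ = angVortQuot (u ·) x`, `Φ = radVelQuot (curl (u ·)) x`, `u_θ/r = angVelQuot`,
`u_r/r = radVelQuot`, `q = radDerivQuot`). [cite: Seregin2022LocalAxisym, §2 Step 3 (arXiv:2201.00153 p. 6, the equations of Φ and Γ)] -/
theorem seregin_quotientEquations_of_isSmoothAxisymmetricSolutionOn : ∀ (S : TopologicalSpace.Opens (ℝ × EuclideanSpace ℝ (Fin 3))) (V u : ℝ → EuclideanSpace ℝ (Fin 3) → EuclideanSpace ℝ (Fin 3)) (p : ℝ → EuclideanSpace ℝ (Fin 3) → ℝ) (I : Set ℝ) (U : Set (EuclideanSpace ℝ (Fin 3))) (t : ℝ) (x : EuclideanSpace ℝ (Fin 3)), SereginZajaczkowski2007.IsSmoothAxisymmetricSolutionOn S V p → IsOpen I → IsOpen U → I ×ˢ U ⊆ (S : Set (ℝ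 × EuclideanSpace ℝ (Fin 3))) → (∀ t ∈ I, ContDiff ℝ (⊤ : ℕ∞) (u t)) → (∀ t ∈ I, IsAxisymmetric (u t)) → (∀ t ∈ I, ∀ x ∈ U, u t =ᶠ[𝓝 x] V t) → t ∈ I → x ∈ U → cylRadius x ≠ 0 → HasDerivAt (fun s => angVortQuot (u s) x) ((Δ (angVortQuot (u t))) x + 2 * radDerivQuot (angVortQuot (u t)) x - fderiv ℝ (angVortQuot (u t)) x (u t x) - 2 * angVelQuot (u t) x * radVelQuot (curl (u t)) x) t ∧ HasDerivAt (fun s => radVelQuot (curl (u s)) x) ((Δ (radVelQuot (curl (u t)))) x + 2 * radDerivQuot (radVelQuot (curl (u t))) x - fderiv ℝ (radVelQuot (curl (u t))) x (u t x) + fderiv ℝ (radVelQuot (u t)) x (curl (u t) x)) t := by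
  intro Scl V u p I U t x hV hI hU hsub hu hax hloc ht hx hxr
  obtain ⟨hΓ, hΦ⟩ := hasDerivAt_quotients_of_isSmoothAxisymmetricSolutionOn hV hI hU hsub hu hax
    hloc ht hx hxr
  have eΓ := angVelQuot_vorticityRHS_eq (u t) 1 (hu t ht) (hax t ht) x
  have eΦ := radVelQuot_vorticityRHS_eq (u t) 1 (hu t ht) (hax t ht) x
  exact ⟨hΓ.congr_deriv (by linarith), hΦ.congr_deriv (by linarith)⟩

end LocalClass

end Summit.NavierStokesRegularity.NavierStokesRegularity.Theorems.AxisymmetricKatoGlobal.EulerScaling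

end
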